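import Summits.ABC.StewartYu.SatCoords
import Summits.ABC.StewartYu.PadicG3SatKStep
import HarnessLib

/-!
# Cell abc-stewartyu, WP-L.P(odd) (crux r3 `PadicCoreOddRat`, stmt-ABC-20503): the SATURATION DATUM of an odd-`p` Gen-3 set-up —
# virtual coordinates, the two clearing denominators (k-step box and half-step floor box) supplied from the VIRTUAL box, the
# θ-coordinate box and the coefficient transport

`Summits/ABC/StewartYu/PadicG3SatData.lean` — cell `abc-stewartyu` (HOME `run/shared/lean/pub/abc-stewartyu/`, design memo
HOME/p2/memo-07-WPLP-odd-Nframe-design.md §1–§2; seat p2-g6).  One structure and theorems on `G3Setup`; no named fact, no parameters.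

`S.SatData` records that the generators `S.α` of the set-up (the frame's `θ`: a Kummer basis of the saturation of the original group) are
POSITIVE and tied to the ORIGINAL positive generators `αo` and coefficients `bo` by

  `S.α i ^ N = ∏ⱼ αo j ^ U i j`,  `αo j = ∏ᵢ S.α i ^ C j i`,  `U * C = N • 1 = C * U`,  `S.b = bo ᵥ* C`

(`N` the saturation index, `U = N·ū`, `C` the integer coordinates of `ℤⁿ ⊂ 𝔑`; memo §1).  The VIRTUAL exponent vector of `μ ∈ ℤⁿ`
(θ-coordinates) is `ν(μ) = μ ᵥ* U ∈ ℤⁿ` (`= N·λ`, `λ` the α-coordinates).  From it: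

* `vecMul_U_vecMul_C` (`ν(μ) ᵥ* C = N•μ`), `natCast_N_mul_abs_le_of_vbox` (θ-box from the virtual box: `N·|μₖ| ≤ Σⱼ Bvⱼ·|Cⱼₖ|`),
  `b_vecMul_U` (`S.b ᵥ* U = N • bo`), `prod_zpow_b_eq` (`∏ θᵢ^{bᵢ} = ∏ αoⱼ^{boⱼ}`);
* k-step box: `E`, `Dm = monDen αo (E Bv x)` (`Eⱼ(x) = ⌈Bvⱼ|x|/N⌉`), `exists_int_Dm_mul_prod` / **`monomialDatum_of_vbox`** — for
  `|ν(w)ⱼ| ≤ Bvⱼ`: `Dm·∏ (S.α j)^{wⱼx} ∈ ℤ`, `|·| ≤ Dm²` (the `hm` of `PadicG3SatKStep.g3_kstep_pm_gen`), `log_Dm_le_of_weights`;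
* half-step floor box: `Ucol`, `Eh`, `Dh = monDen αo (Eh Bv s)` (`Ehⱼ(s) = ⌈(|s|Bvⱼ + Σᵢ|Uᵢⱼ|)/(2N)⌉`), **`exists_int_Dh_mul_prod_floor`** —
  for `|ν(w)ⱼ| ≤ Bvⱼ`: `Dh·∏ (S.α j)^{⌊wⱼ s/2⌋} ∈ ℤ`, `|·| ≤ Dh²` (the rational part of the root monomial at the half point `s/2`, SIGNED,
  cleared virtually: `2·ν(⌊ws/2⌋) = s·ν(w) − ν(ε)`, `ε ∈ {0,1}ⁿ`), `log_Dh_le_of_weights`, `logHeight₁_prod_zpow_floor_le_of_vbox`;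
* `logHeight₁_prod_zpow_le_of_vbox` — `h(∏ (S.α j)^{wⱼ}) ≤ Σⱼ (Bvⱼ/N)·Vⱼ`.

WHAT THIS IS NOT: no lattice (the existence of `θ, U, C, N` with size bounds is `SatBasisReduced`, p1); no analysis; no crux moves.

References: Yu. V. Nesterenko, LNM 1819 (2003) §3.5, Lemma 3.11, §4.3 (4.50); K. Yu, Acta Math. 211 (2013) §1.1.
-/

noncomputable section

open Finset
open scoped Matrix
open Literature.NumberTheory.Transcendental

namespace Summit.ABC.StewartYu

namespace G3Setup

variable {p : ℕ} [Fact p.Prime] (S : G3Setup p)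

/-- **The saturation datum of a set-up**: positive generators `S.α` (the saturated basis `θ`), positive ORIGINAL generators `αo` and
original coefficients `bo`, integer matrices `U`, `C` and the index `0 < N` with `θᵢ^N = ∏ⱼ αoⱼ^{Uᵢⱼ}`, `αoⱼ = ∏ᵢ θᵢ^{Cⱼᵢ}`,
`U·C = N·1 = C·U`, `S.b = bo ᵥ* C`. [cite: Nesterenko2003, §3.5 and Cor 4.5; shape only] -/
structure SatData where
  /-- the original generators -/
  αo : Fin S.n → ℚ
  /-- they are positive -/
  hαo : ∀ j, 0 < αo j
  /-- the set-up's generators (the saturated basis) are positive -/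
  hθ : ∀ i, 0 < S.α i
  /-- the integer matrix `N·ū` (`θᵢ^N = αo^{Uᵢ}`) -/
  U : Matrix (Fin S.n) (Fin S.n) ℤ
  /-- the integer coordinates of the original generators in the basis (`αoⱼ = θ^{Cⱼ}`) -/
  C : Matrix (Fin S.n) (Fin S.n) ℤ
  /-- the saturation index -/
  N : ℕ
  /-- it is positive -/
  hN : 0 < N
  /-- `θᵢ^N = ∏ⱼ αoⱼ^{Uᵢⱼ}` -/
  hU : ∀ i, S.α i ^ N = ∏ j, αo j ^ U i j
  /-- `αoⱼ = ∏ᵢ θᵢ^{Cⱼᵢ}` -/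
  hC : ∀ j, αo j = ∏ i, S.α i ^ C j i
  /-- `U·C = N·1` -/
  hUC : U * C = (N : ℤ) • (1 : Matrix (Fin S.n) (Fin S.n) ℤ)
  /-- `C·U = N·1` -/
  hCU : C * U = (N : ℤ) • (1 : Matrix (Fin S.n) (Fin S.n) ℤ)
  /-- the original coefficients -/
  bo : Fin S.n → ℤ
  /-- the set-up's coefficients are the transported ones: `bᵢ = Σⱼ boⱼ Cⱼᵢ` -/
  hb : S.b = bo ᵥ* C

namespace SatData

variable {S} (F : S.SatData)

/-! ### Coordinates -/

/-- The original generators are non-zero. [folklore] -/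
theorem αo_ne (j : Fin S.n) : F.αo j ≠ 0 := (F.hαo j).ne'

/-- `ν(μ) ᵥ* C = N • μ`: the θ-coordinates are recovered from the virtual ones. [folklore] -/
theorem vecMul_U_vecMul_C (μ : Fin S.n → ℤ) : (μ ᵥ* F.U) ᵥ* F.C = (F.N : ℤ) • μ := by
  rw [Matrix.vecMul_vecMul, F.hUC, Matrix.vecMul_smul, Matrix.vecMul_one]

/-- `ν(b) = N • bo`: the virtual coordinates of the set-up's coefficient vector. [folklore] -/
theorem b_vecMul_U : S.b ᵥ* F.U = (F.N : ℤ) • F.bo := by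
  rw [F.hb, Matrix.vecMul_vecMul, F.hCU, Matrix.vecMul_smul, Matrix.vecMul_one]

/-- `bo ≠ 0` as soon as `b ≠ 0` (automatic: `b_{j₀} ≠ 0`). [folklore] -/
theorem bo_ne_zero : F.bo ≠ 0 := by
  intro h0
  have h := F.hb
  rw [h0, Matrix.zero_vecMul] at h
  exact S.bj₀_ne (by rw [h]; rfl)

/-- **The θ-box from the virtual box**: `|ν(μ)ⱼ| ≤ Bvⱼ` for all `j` ⇒ `N·|μₖ| ≤ Σⱼ Bvⱼ·|Cⱼₖ|`. [folklore] -/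
theorem natCast_N_mul_abs_le_of_vbox {Bv : Fin S.n → ℕ} {μ : Fin S.n → ℤ} (h : ∀ j, |(μ ᵥ* F.U) j| ≤ (Bv j : ℤ)) (k : Fin S.n) :
    (F.N : ℤ) * |μ k| ≤ ∑ j, (Bv j : ℤ) * |F.C j k| := by
  have e := congrFun (F.vecMul_U_vecMul_C μ) k
  simp only [Pi.smul_apply, smul_eq_mul] at e
  have e2 : (F.N : ℤ) * μ k = ∑ j, (μ ᵥ* F.U) j * F.C j k := by
    rw [← e]; rfl
  have hN0 : (0 : ℤ) ≤ F.N := by exact_mod_cast F.hN.le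
  calc (F.N : ℤ) * |μ k| = |(F.N : ℤ) * μ k| := by rw [abs_mul, abs_of_nonneg hN0]
    _ = |∑ j, (μ ᵥ* F.U) j * F.C j k| := by rw [e2]
    _ ≤ ∑ j, |(μ ᵥ* F.U) j * F.C j k| := abs_sum_le_sum_abs _ _
    _ ≤ ∑ j, (Bv j : ℤ) * |F.C j k| := sum_le_sum fun j _ => by
        rw [abs_mul]; exact mul_le_mul_of_nonneg_right (h j) (abs_nonneg _)

/-- **The coefficient transport**: `∏ᵢ θᵢ^{bᵢ} = ∏ⱼ αoⱼ^{boⱼ}` (so `ord_p(θ^b − 1) = ord_p(αo^{bo} − 1)`). [folklore] -/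
theorem prod_zpow_b_eq : ∏ i, S.α i ^ S.b i = ∏ j, F.αo j ^ F.bo j := by
  rw [F.hb]
  exact SatCoords.prod_zpow_vecMul_eq F.αo S.α S.α_ne F.C F.hC F.bo

/-! ### The k-step box denominator -/

/-- The α-box exponent at the point `x` of the virtual box `Bv`: `Eⱼ(x) = ⌈Bvⱼ·|x|/N⌉`. [folklore] -/
def E (Bv : Fin S.n → ℕ) (x : ℤ) : Fin S.n → ℕ := fun j => (Bv j * x.natAbs + F.N - 1) / F.N

/-- `Bvⱼ·|x| ≤ N·Eⱼ(x)`. [folklore] -/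
theorem le_N_mul_E (Bv : Fin S.n → ℕ) (x : ℤ) (j : Fin S.n) : Bv j * x.natAbs ≤ F.N * F.E Bv x j := by
  unfold E
  have hN := F.hN
  have h := Nat.lt_div_mul_add (a := Bv j * x.natAbs + F.N - 1) hN
  rw [Nat.mul_comm F.N]
  omega

/-- A ceiling bound in real form: `⌈a/N⌉ ≤ a/N + 1`, i.e. `((a + N − 1)/N : ℕ) ≤ a/N + 1`. [folklore] -/
theorem ceilDiv_le (a : ℕ) : (((a + F.N - 1) / F.N : ℕ) : ℝ) ≤ (a : ℝ) / F.N + 1 := by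
  have hN := F.hN
  have hNr : (0 : ℝ) < F.N := by exact_mod_cast hN
  have h1 : ((a + F.N - 1) / F.N : ℕ) * F.N ≤ a + F.N - 1 := Nat.div_mul_le_self _ _
  have h2 : (((a + F.N - 1) / F.N : ℕ) : ℝ) * F.N ≤ (a : ℝ) + F.N := by
    have : (((a + F.N - 1) / F.N * F.N : ℕ) : ℝ) ≤ ((a + F.N - 1 : ℕ) : ℝ) := by exact_mod_cast h1
    have h3 : ((a + F.N - 1 : ℕ) : ℝ) ≤ (a : ℝ) + F.N := by
      have : a + F.N - 1 ≤ a + F.N := Nat.sub_le _ _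
      exact_mod_cast this
    push_cast at this
    linarith
  rw [div_add_one hNr.ne', le_div_iff₀ hNr]
  linarith

/-- `Eⱼ(x) ≤ Bvⱼ·|x|/N + 1` (real form). [folklore] -/
theorem E_le (Bv : Fin S.n → ℕ) (x : ℤ) (j : Fin S.n) :
    (F.E Bv x j : ℝ) ≤ (Bv j : ℝ) * |(x : ℝ)| / F.N + 1 := by
  have h := F.ceilDiv_le (Bv j * x.natAbs)
  unfold E
  push_cast at h
  rw [Nat.cast_natAbs, Int.cast_abs] at h
  exact h

/-- The clearing denominator of the virtual box at the point `x`: `Dm = monDen αo (E x)`. [cite: Nesterenko2003, Lemma 3.11; shape only] -/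
def Dm (Bv : Fin S.n → ℕ) (x : ℤ) : ℕ := MonomialDen.monDen F.αo (F.E Bv x)

/-- `1 ≤ Dm`. [folklore] -/
theorem one_le_Dm (Bv : Fin S.n → ℕ) (x : ℤ) : 1 ≤ F.Dm Bv x := MonomialDen.one_le_monDen _ F.αo_ne _

/-- `log Dm ≤ 2·Σⱼ Eⱼ(x)·h(αoⱼ)`. [cite: Nesterenko2003, §3.2; shape only] -/
theorem log_Dm_le (Bv : Fin S.n → ℕ) (x : ℤ) :
    Real.log (F.Dm Bv x : ℝ) ≤ 2 * ∑ j, (F.E Bv x j : ℝ) * Height.logHeight₁ (F.αo j) :=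
  MonomialDen.log_monDen_le _ F.αo_ne _

/-- `log Dm ≤ 2·|x|·Σⱼ (Bvⱼ/N)·Vⱼ + 2·Σⱼ Vⱼ` for weights `h(αoⱼ) ≤ Vⱼ` (box height with the rounding slop).
[cite: Nesterenko2003, Lemma 3.11; shape only] -/
theorem log_Dm_le_of_weights (Bv : Fin S.n → ℕ) (x : ℤ) (V : Fin S.n → ℝ) (hV : ∀ j, Height.logHeight₁ (F.αo j) ≤ V j) :
    Real.log (F.Dm Bv x : ℝ) ≤ 2 * |(x : ℝ)| * ∑ j, ((Bv j : ℝ) / F.N) * V j + 2 * ∑ j, V j := by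
  have h := F.log_Dm_le Bv x
  have h2 : ∑ j, (F.E Bv x j : ℝ) * Height.logHeight₁ (F.αo j) ≤ ∑ j, ((Bv j : ℝ) * |(x : ℝ)| / F.N + 1) * V j := by
    refine Finset.sum_le_sum fun j _ => ?_
    exact mul_le_mul (F.E_le Bv x j) (hV j) (Height.zero_le_logHeight₁ _) (by have := F.E_le Bv x j; positivity)
  have h3 : ∑ j, ((Bv j : ℝ) * |(x : ℝ)| / F.N + 1) * V j = |(x : ℝ)| * ∑ j, ((Bv j : ℝ) / F.N) * V j + ∑ j, V j := by
    rw [Finset.mul_sum, ← Finset.sum_add_distrib]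
    refine Finset.sum_congr rfl fun j _ => ?_
    ring
  linarith

/-- **The monomials of the virtual box cleared**: for `|ν(w)ⱼ| ≤ Bvⱼ`, `Dm·∏ⱼ (S.α j)^{wⱼ·x} ∈ ℤ` with `|·| ≤ Dm²`.
[cite: Nesterenko2003, Lemma 3.11; shape only] -/
theorem exists_int_Dm_mul_prod {Bv : Fin S.n → ℕ} {w : Fin S.n → ℤ} (hw : ∀ j, |(w ᵥ* F.U) j| ≤ (Bv j : ℤ)) (x : ℤ) :
    ∃ z : ℤ, ((F.Dm Bv x : ℕ) : ℚ) * ∏ j, S.α j ^ (w j * x) = z ∧ |z| ≤ ((F.Dm Bv x : ℤ)) ^ 2 := by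
  have hμ : (fun j => w j * x) = x • w := by
    funext j; simp [mul_comm]
  have hbox : ∀ j, |((fun j => w j * x) ᵥ* F.U) j| ≤ (F.N : ℤ) * (F.E Bv x j : ℕ) := by
    intro j
    rw [hμ, Matrix.smul_vecMul, Pi.smul_apply, smul_eq_mul, abs_mul, mul_comm]
    have h1 : |(w ᵥ* F.U) j| * |x| ≤ (Bv j : ℤ) * |x| := mul_le_mul_of_nonneg_right (hw j) (abs_nonneg _)
    have h2 : (Bv j : ℤ) * |x| ≤ (F.N : ℤ) * (F.E Bv x j : ℕ) := by
      have := F.le_N_mul_E Bv x j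
      rw [Int.abs_eq_natAbs]
      exact_mod_cast this
    exact h1.trans h2
  exact SatCoords.exists_int_monDen_mul_prod_zpow_sat F.αo S.α F.U F.N F.hαo F.hθ F.hN F.hU (F.E Bv x) _ hbox

/-- **The monomial datum of the k-step from the virtual box** (the hypothesis `hm` of `PadicG3SatKStep.g3_kstep_pm_gen`, `Mm = Dm²`).
[cite: Nesterenko2003, Lemma 3.11; shape only] -/
theorem monomialDatum_of_vbox {ι : Type*} {B : Finset ι} {v : ι → Fin S.n → ℤ} {Bv : Fin S.n → ℕ}
    (hv : ∀ i ∈ B, ∀ j, |(v i ᵥ* F.U) j| ≤ (Bv j : ℤ)) :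
    ∀ x : ℤ, ∀ i ∈ B, ∃ z₂ : ℤ, ((F.Dm Bv x : ℕ) : ℚ) * ∏ j, S.α j ^ (v i j * x) = z₂ ∧
      |z₂| ≤ ((F.Dm Bv x : ℤ)) ^ 2 :=
  fun x i hi => F.exists_int_Dm_mul_prod (hv i hi) x

/-- **The box-height ceiling of the virtual box**: for `|ν(w)ⱼ| ≤ Bvⱼ` and `h(αoⱼ) ≤ Vⱼ`, `h(∏ (S.α j)^{wⱼ}) ≤ Σⱼ (Bvⱼ/N)·Vⱼ`.
[cite: Nesterenko2003, Lemma 3.11; shape only] -/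
theorem logHeight₁_prod_zpow_le_of_vbox {Bv : Fin S.n → ℕ} {w : Fin S.n → ℤ} (hw : ∀ j, |(w ᵥ* F.U) j| ≤ (Bv j : ℤ))
    (V : Fin S.n → ℝ) (hV : ∀ j, Height.logHeight₁ (F.αo j) ≤ V j) :
    Height.logHeight₁ (∏ j, S.α j ^ w j) ≤ ∑ j, ((Bv j : ℝ) / F.N) * V j := by
  have hN' : (0 : ℝ) < F.N := by exact_mod_cast F.hN
  have h := SatCoords.natCast_mul_logHeight₁_prod_zpow_le F.αo S.α F.U F.N F.αo_ne F.hU w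
  have h2 : ∑ j, (|(w ᵥ* F.U) j| : ℝ) * Height.logHeight₁ (F.αo j) ≤ ∑ j, (F.N : ℝ) * (((Bv j : ℝ) / F.N) * V j) := by
    refine Finset.sum_le_sum fun j _ => ?_
    have h0 : 0 ≤ Height.logHeight₁ (F.αo j) := Height.zero_le_logHeight₁ _
    have h1 : (|(w ᵥ* F.U) j| : ℝ) ≤ (Bv j : ℝ) := by exact_mod_cast hw j
    have hB0 : (0 : ℝ) ≤ Bv j := Nat.cast_nonneg _
    calc (|(w ᵥ* F.U) j| : ℝ) * Height.logHeight₁ (F.αo j) ≤ (Bv j : ℝ) * Height.logHeight₁ (F.αo j) :=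
          mul_le_mul_of_nonneg_right h1 h0
      _ ≤ (Bv j : ℝ) * V j := mul_le_mul_of_nonneg_left (hV j) hB0
      _ = (F.N : ℝ) * (((Bv j : ℝ) / F.N) * V j) := by field_simp
  rw [← Finset.mul_sum] at h2
  exact le_of_mul_le_mul_left (h.trans h2) hN'

/-! ### The half-step floor box denominator -/

/-- The column sums `Σᵢ |Uᵢⱼ|` of the saturation matrix. [folklore] -/
def Ucol (j : Fin S.n) : ℕ := ∑ i, (F.U i j).natAbs

/-- `(Ucol j : ℤ) = Σᵢ |Uᵢⱼ|`. [folklore] -/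
theorem cast_Ucol (j : Fin S.n) : (F.Ucol j : ℤ) = ∑ i, |F.U i j| := by
  simp only [Ucol, Nat.cast_sum, Int.natCast_natAbs]

/-- The α-box exponent of the FLOOR half-point monomial `∏ θⱼ^{⌊wⱼ s/2⌋}`: `Ehⱼ(s) = ⌈(|s|·Bvⱼ + Σᵢ|Uᵢⱼ|)/(2N)⌉`. [folklore] -/
def Eh (Bv : Fin S.n → ℕ) (s : ℤ) : Fin S.n → ℕ := fun j => (s.natAbs * Bv j + F.Ucol j + 2 * F.N - 1) / (2 * F.N)

/-- `|s|·Bvⱼ + Σᵢ|Uᵢⱼ| ≤ 2N·Ehⱼ(s)`. [folklore] -/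
theorem le_two_N_mul_Eh (Bv : Fin S.n → ℕ) (s : ℤ) (j : Fin S.n) : s.natAbs * Bv j + F.Ucol j ≤ 2 * F.N * F.Eh Bv s j := by
  unfold Eh
  have hN : 0 < 2 * F.N := by have := F.hN; omega
  have h := Nat.lt_div_mul_add (a := s.natAbs * Bv j + F.Ucol j + 2 * F.N - 1) hN
  rw [Nat.mul_comm (2 * F.N)]
  omega

/-- `Ehⱼ(s) ≤ (|s|·Bvⱼ + Σᵢ|Uᵢⱼ|)/(2N) + 1` (real form). [folklore] -/
theorem Eh_le (Bv : Fin S.n → ℕ) (s : ℤ) (j : Fin S.n) :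
    (F.Eh Bv s j : ℝ) ≤ (|(s : ℝ)| * (Bv j : ℝ) + F.Ucol j) / (2 * F.N) + 1 := by
  have hN' : (0 : ℝ) < F.N := by exact_mod_cast F.hN
  have hNr : (0 : ℝ) < 2 * F.N := by linarith
  set a : ℕ := s.natAbs * Bv j + F.Ucol j with ha
  have h1 : ((a + 2 * F.N - 1) / (2 * F.N) : ℕ) * (2 * F.N) ≤ a + 2 * F.N - 1 := Nat.div_mul_le_self _ _
  have h2 : (((a + 2 * F.N - 1) / (2 * F.N) : ℕ) : ℝ) * (2 * F.N) ≤ (a : ℝ) + 2 * F.N := by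
    have : (((a + 2 * F.N - 1) / (2 * F.N) * (2 * F.N) : ℕ) : ℝ) ≤ ((a + 2 * F.N - 1 : ℕ) : ℝ) := by exact_mod_cast h1
    have h3 : ((a + 2 * F.N - 1 : ℕ) : ℝ) ≤ (a : ℝ) + 2 * F.N := by
      have : a + 2 * F.N - 1 ≤ a + 2 * F.N := Nat.sub_le _ _
      exact_mod_cast this
    push_cast at this
    linarith
  have hcast : (a : ℝ) = |(s : ℝ)| * (Bv j : ℝ) + F.Ucol j := by
    rw [ha]; push_cast; rw [Nat.cast_natAbs, Int.cast_abs]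
  unfold Eh
  rw [← ha, div_add_one hNr.ne', le_div_iff₀ hNr, ← hcast]
  linarith

/-- The clearing denominator of the floor half-point monomials of the virtual box: `Dh = monDen αo (Eh s)`.
[cite: Nesterenko2003, §4.3 (4.50); shape only] -/
def Dh (Bv : Fin S.n → ℕ) (s : ℤ) : ℕ := MonomialDen.monDen F.αo (F.Eh Bv s)

/-- `1 ≤ Dh`. [folklore] -/
theorem one_le_Dh (Bv : Fin S.n → ℕ) (s : ℤ) : 1 ≤ F.Dh Bv s := MonomialDen.one_le_monDen _ F.αo_ne _

/-- `log Dh ≤ |s|·Σⱼ (Bvⱼ/N)·Vⱼ + Σⱼ (Σᵢ|Uᵢⱼ|/N)·Vⱼ + 2·Σⱼ Vⱼ` for weights `h(αoⱼ) ≤ Vⱼ`. [cite: Nesterenko2003, §4.3; shape only] -/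
theorem log_Dh_le_of_weights (Bv : Fin S.n → ℕ) (s : ℤ) (V : Fin S.n → ℝ) (hV : ∀ j, Height.logHeight₁ (F.αo j) ≤ V j) :
    Real.log (F.Dh Bv s : ℝ) ≤
      |(s : ℝ)| * ∑ j, ((Bv j : ℝ) / F.N) * V j + ∑ j, ((F.Ucol j : ℝ) / F.N) * V j + 2 * ∑ j, V j := by
  have hNr : (0 : ℝ) < F.N := by exact_mod_cast F.hN
  have h : Real.log (F.Dh Bv s : ℝ) ≤ 2 * ∑ j, (F.Eh Bv s j : ℝ) * Height.logHeight₁ (F.αo j) :=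
    MonomialDen.log_monDen_le _ F.αo_ne _
  have h2 : ∑ j, (F.Eh Bv s j : ℝ) * Height.logHeight₁ (F.αo j) ≤
      ∑ j, ((|(s : ℝ)| * (Bv j : ℝ) + F.Ucol j) / (2 * F.N) + 1) * V j := by
    refine Finset.sum_le_sum fun j _ => ?_
    exact mul_le_mul (F.Eh_le Bv s j) (hV j) (Height.zero_le_logHeight₁ _) (by have := F.Eh_le Bv s j; positivity)
  have h3 : 2 * ∑ j, ((|(s : ℝ)| * (Bv j : ℝ) + F.Ucol j) / (2 * F.N) + 1) * V j =
      |(s : ℝ)| * ∑ j, ((Bv j : ℝ) / F.N) * V j + ∑ j, ((F.Ucol j : ℝ) / F.N) * V j + 2 * ∑ j, V j := by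
    rw [Finset.mul_sum, Finset.mul_sum, Finset.mul_sum, ← Finset.sum_add_distrib, ← Finset.sum_add_distrib]
    refine Finset.sum_congr rfl fun j _ => ?_
    simp only [div_eq_mul_inv, mul_inv]
    ring
  linarith

/-- **The virtual exponents of the floor vector**: `2·ν(⌊w s/2⌋)ⱼ = s·ν(w)ⱼ − Σᵢ εᵢ Uᵢⱼ` with `εᵢ = (wᵢ s) mod 2 ∈ {0,1}`, hence
`2·|ν(⌊w s/2⌋)ⱼ| ≤ |s|·|ν(w)ⱼ| + Σᵢ |Uᵢⱼ|`. [cite: Nesterenko2003, §4.3 (4.50); shape only] -/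
theorem two_mul_abs_vecMul_floor_le (w : Fin S.n → ℤ) (s : ℤ) (j : Fin S.n) :
    2 * |((fun i => w i * s / 2) ᵥ* F.U) j| ≤ |s| * |(w ᵥ* F.U) j| + ∑ i, |F.U i j| := by
  have hε : ∀ i, 2 * (w i * s / 2) = w i * s - (w i * s) % 2 := fun i => by omega
  have hε01 : ∀ i, |(w i * s) % 2| ≤ 1 := fun i => by
    rcases Int.emod_two_eq_zero_or_one (w i * s) with h | h <;> simp [h]
  have e1 : 2 * ((fun i => w i * s / 2) ᵥ* F.U) j = s * (w ᵥ* F.U) j - ∑ i, (w i * s) % 2 * F.U i j := by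
    simp only [Matrix.vecMul, dotProduct]
    rw [Finset.mul_sum, Finset.mul_sum, ← Finset.sum_sub_distrib]
    refine sum_congr rfl fun i _ => ?_
    calc 2 * (w i * s / 2 * F.U i j) = (2 * (w i * s / 2)) * F.U i j := by ring
      _ = (w i * s - w i * s % 2) * F.U i j := by rw [hε i]
      _ = s * (w i * F.U i j) - w i * s % 2 * F.U i j := by ring
  calc 2 * |((fun i => w i * s / 2) ᵥ* F.U) j| = |2 * ((fun i => w i * s / 2) ᵥ* F.U) j| := by
        rw [abs_mul]; norm_num
    _ = |s * (w ᵥ* F.U) j - ∑ i, (w i * s) % 2 * F.U i j| := by rw [e1]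
    _ ≤ |s * (w ᵥ* F.U) j| + |∑ i, (w i * s) % 2 * F.U i j| := abs_sub _ _
    _ ≤ |s| * |(w ᵥ* F.U) j| + ∑ i, |F.U i j| := by
        rw [abs_mul]
        refine add_le_add le_rfl ((abs_sum_le_sum_abs _ _).trans (sum_le_sum fun i _ => ?_))
        rw [abs_mul]
        exact (mul_le_mul_of_nonneg_right (hε01 i) (abs_nonneg _)).trans (by rw [one_mul])

/-- **The floor half-point monomials of the virtual box cleared**: for `|ν(w)ⱼ| ≤ Bvⱼ`, `Dh·∏ⱼ (S.α j)^{⌊wⱼ s/2⌋} ∈ ℤ` with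
`|·| ≤ Dh²`. [cite: Nesterenko2003, §4.3 (4.50); shape only] -/
theorem exists_int_Dh_mul_prod_floor {Bv : Fin S.n → ℕ} {w : Fin S.n → ℤ} (hw : ∀ j, |(w ᵥ* F.U) j| ≤ (Bv j : ℤ)) (s : ℤ) :
    ∃ z : ℤ, ((F.Dh Bv s : ℕ) : ℚ) * ∏ j, S.α j ^ (w j * s / 2) = z ∧ |z| ≤ ((F.Dh Bv s : ℤ)) ^ 2 := by
  have hbox : ∀ j, |((fun i => w i * s / 2) ᵥ* F.U) j| ≤ (F.N : ℤ) * (F.Eh Bv s j : ℕ) := by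
    intro j
    have h1 := F.two_mul_abs_vecMul_floor_le w s j
    have h2 : |s| * |(w ᵥ* F.U) j| + ∑ i, |F.U i j| ≤ |s| * (Bv j : ℤ) + (F.Ucol j : ℤ) := by
      rw [F.cast_Ucol]; exact add_le_add (mul_le_mul_of_nonneg_left (hw j) (abs_nonneg _)) le_rfl
    have h3 : |s| * (Bv j : ℤ) + (F.Ucol j : ℤ) ≤ 2 * ((F.N : ℤ) * (F.Eh Bv s j : ℕ)) := by
      have := F.le_two_N_mul_Eh Bv s j
      have h4 : ((s.natAbs * Bv j + F.Ucol j : ℕ) : ℤ) ≤ ((2 * F.N * F.Eh Bv s j : ℕ) : ℤ) := by exact_mod_cast this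
      push_cast at h4
      linarith
    linarith
  exact SatCoords.exists_int_monDen_mul_prod_zpow_sat F.αo S.α F.U F.N F.hαo F.hθ F.hN F.hU (F.Eh Bv s) _ hbox

/-- **The height of the floor half-point monomial**: for `|ν(w)ⱼ| ≤ Bvⱼ` and `h(αoⱼ) ≤ Vⱼ`,
`2·h(∏ (S.α j)^{⌊wⱼ s/2⌋}) ≤ |s|·Σⱼ (Bvⱼ/N)·Vⱼ + Σⱼ (Σᵢ|Uᵢⱼ|/N)·Vⱼ`. [cite: Nesterenko2003, §4.3 (4.50); shape only] -/
theorem two_mul_logHeight₁_prod_zpow_floor_le_of_vbox {Bv : Fin S.n → ℕ} {w : Fin S.n → ℤ}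
    (hw : ∀ j, |(w ᵥ* F.U) j| ≤ (Bv j : ℤ)) (s : ℤ) (V : Fin S.n → ℝ) (hV : ∀ j, Height.logHeight₁ (F.αo j) ≤ V j) :
    2 * Height.logHeight₁ (∏ j, S.α j ^ (w j * s / 2)) ≤
      |(s : ℝ)| * ∑ j, ((Bv j : ℝ) / F.N) * V j + ∑ j, ((F.Ucol j : ℝ) / F.N) * V j := by
  have hN' : (0 : ℝ) < F.N := by exact_mod_cast F.hN
  have h := SatCoords.natCast_mul_logHeight₁_prod_zpow_le F.αo S.α F.U F.N F.αo_ne F.hU (fun i => w i * s / 2)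
  have hb : ∀ j, 2 * (|((fun i => w i * s / 2) ᵥ* F.U) j| : ℝ) ≤ |(s : ℝ)| * (Bv j : ℝ) + F.Ucol j := by
    intro j
    have h1 := F.two_mul_abs_vecMul_floor_le w s j
    have h2 : |s| * |(w ᵥ* F.U) j| + ∑ i, |F.U i j| ≤ |s| * (Bv j : ℤ) + (F.Ucol j : ℤ) := by
      rw [F.cast_Ucol]; exact add_le_add (mul_le_mul_of_nonneg_left (hw j) (abs_nonneg _)) le_rfl
    have h3 := (Int.cast_le (R := ℝ)).mpr (h1.trans h2)
    push_cast at h3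
    exact h3
  have h2 : 2 * ∑ j, (|((fun i => w i * s / 2) ᵥ* F.U) j| : ℝ) * Height.logHeight₁ (F.αo j) ≤
      ∑ j, (|(s : ℝ)| * (Bv j : ℝ) + F.Ucol j) * V j := by
    rw [Finset.mul_sum]
    refine Finset.sum_le_sum fun j _ => ?_
    have h0 : 0 ≤ Height.logHeight₁ (F.αo j) := Height.zero_le_logHeight₁ _
    rw [← mul_assoc]
    exact mul_le_mul (hb j) (hV j) h0 (by positivity)
  have h3 : ∑ j, (|(s : ℝ)| * (Bv j : ℝ) + F.Ucol j) * V j =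
      (F.N : ℝ) * (|(s : ℝ)| * ∑ j, ((Bv j : ℝ) / F.N) * V j + ∑ j, ((F.Ucol j : ℝ) / F.N) * V j) := by
    rw [Finset.mul_sum, mul_add, Finset.mul_sum, Finset.mul_sum, ← Finset.sum_add_distrib]
    refine Finset.sum_congr rfl fun j _ => ?_
    field_simp
  have h4 : (F.N : ℝ) * (2 * Height.logHeight₁ (∏ j, S.α j ^ (w j * s / 2))) ≤
      (F.N : ℝ) * (|(s : ℝ)| * ∑ j, ((Bv j : ℝ) / F.N) * V j + ∑ j, ((F.Ucol j : ℝ) / F.N) * V j) := by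
    rw [← h3]; nlinarith [h, h2]
  exact le_of_mul_le_mul_left h4 hN'

end SatData

end G3Setup

end Summit.ABC.StewartYu

end
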